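import Mathlib
import Literature.Probability.Percolation.CornerPercolation
import Literature.Probability.Percolation.PercolationEvents
import Literature.Probability.Percolation.ProdBernoulliRusso
import Summits.CriticalPhenomena.CardyFormulaZ2.Theses.CardySelfDualSegment

/-!
# Vocabulary of the line `pivotal-balance-heat-flow` for the crux `UniformMarginality`
(stmt-CriticalPhenomena-5472, route `CardySelfDualSegment`)

Definitions-only support file of the lead's skeleton
(`Cruxes/UniformMarginality/Lines/Sketch.lean`): the line's VOCABULARY (`crossEvent`, `Pext`,
`M`, `russoIntegrand`, `pivCountIn`), the stub STATEMENTS as named `Prop`s (`RussoIdentity`,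
`PextContinuous`, `RussoBound`; the diagnostic identity `PivotalBalance`; the integrated form
`IntegratedBound`), and the PROVED glue: `integratedBound_of` (mean value theorem on `[0,1]`)
and `uniformMarginality_of_integratedBound`, composed in `uniformMarginality_of_stubs`, which
concludes the crux decl `CardySelfDualSegment.UniformMarginality` BY NAME from the three stubs.
Nothing here is asserted: every `def … : Prop` is a statement the LINE POSITS (a sub-goal of the
crux, to be proved by a registered stub file `Theorems/CardySelfDualSegmentUniformMarginalityStub…`
or by the glue), not a literature fact, never to be relocated.

The line (idea card `Cruxes/UniformMarginality/Ideas/pivotal-balance-heat-flow.md`): the corner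
family `M_t = cornerPercolation t` is the time-marginal of the XOR heat flow on the splitting
bits, so `∂_t P_t(R, δ)` is the finite Margulis–Russo sum
`½ Σ_v E_t[(1 − 2 c_v) 𝟙{N_v pivotal}]` (`RussoIdentity`, exact at every mesh); the crux in
Lipschitz form is a δ-uniform bound on that signed census (`RussoBound`, the research stub); the
mean value theorem turns it into the δ-uniform modulus of continuity `IntegratedBound`, which is
the crux read through `Pext R δ t = cornerCrossingProb t R δ = P t R δ` (`Pext_coe`, definitional
over `CornerPercolation.lean`).
-/

noncomputable section

namespace Summit.CriticalPhenomena.CardyFormulaZ2.Cruxes.UniformMarginality.HeatFlow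

open MeasureTheory Literature.Probability.Percolation Literature.Probability.LatticeModels
  Literature.Probability.RandomPlanarGeometry
open scoped Classical

/-! ## §1 Vocabulary -/

/-- The crude crossing event of the conformal rectangle `R` at mesh `δ` on `√2 ℤ²`
(the event inside `cornerCrossingProb`: an open path with all vertices in `R.carrier` from within
`2δ` of `R.arc 0` to within `2δ` of `R.arc 2`). -/
def crossEvent (R : ConformalRectangle) (δ : ℝ) : Set (BondConfig (Site 2)) :=
  embDomainCrossing squareLatticeEmbedding.z R.carrier δ (R.arc 0) (R.arc 2)

/-- The north edge `{v, v + (0,1)}` of the vertex `v`. -/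
def northEdge (v : Site 2) : Sym2 (Site 2) := s(v, v + ![0, 1])

/-- The east edge `{v, v + (1,0)}` of the vertex `v`. -/
def eastEdge (v : Site 2) : Sym2 (Site 2) := s(v, v + ![1, 0])

/-- `P_t(R, δ)` extended to a function of a real parameter (constant outside `[0,1]`):
`Pext R δ s = cornerCrossingProb (projIcc 0 1 s) R δ`. -/
def Pext (R : ConformalRectangle) (δ : ℝ) (s : ℝ) : ℝ :=
  cornerCrossingProb (Set.projIcc (0 : ℝ) 1 zero_le_one s) R δ

/-- The law `M_t` at a real parameter (projected to `[0,1]`). -/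
def M (s : ℝ) : Measure (BondConfig (Site 2)) :=
  cornerPercolation (Set.projIcc (0 : ℝ) 1 zero_le_one s)

/-- Russo integrand of the corner deformation at the vertex `v`:
`X_v(ω) = (1 − 2·𝟙{E_v ∈ ω}) · 𝟙{N_v pivotal for A in ω}`. -/
def russoIntegrand (A : Set (BondConfig (Site 2))) (v : Site 2) (ω : BondConfig (Site 2)) : ℝ :=
  (if eastEdge v ∈ ω then (-1 : ℝ) else 1) * (if IsPivotal A (northEdge v) ω then 1 else 0)

/-- Number of pivotal edges for `A` in `ω` among the edges of the finite set `K`. -/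
def pivCountIn (K : Finset (Sym2 (Site 2))) (A : Set (BondConfig (Site 2)))
    (ω : BondConfig (Site 2)) : ℕ :=
  (K.filter fun e => IsPivotal A e ω).card

/-! ## §2 The stub statements (posited by the line; proved in the stub files or open) -/

/-- STUB (R) — **Russo / heat-flow identity** (finite Margulis–Russo in the splitting bits
`d_v ~ Bernoulli(t/2)`; flipping `d_v` flips the north edge `N_v`, in the direction
`closed → open` iff the coin `c_v = 𝟙{E_v open}` is `0`): for `δ > 0` there is a finite set `K`
of vertices outside which no north edge is ever pivotal for the crude crossing event, and
`∂_t P_t(R,δ) = ½ Σ_{v ∈ K} E_t[(1 − 2 c_v) 𝟙{N_v pivotal}]` at every `t ∈ (0,1)`. -/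
def RussoIdentity : Prop :=
  ∀ (R : ConformalRectangle) (δ : ℝ), 0 < δ → ∃ K : Finset (Site 2),
    (∀ ω, ∀ v ∉ K, ¬ IsPivotal (crossEvent R δ) (northEdge v) ω) ∧
    ∀ t ∈ Set.Ioo (0 : ℝ) 1,
      HasDerivAt (Pext R δ)
        ((1 / 2 : ℝ) * ∑ v ∈ K, ∫ ω, russoIntegrand (crossEvent R δ) v ω ∂(M t)) t

/-- STUB (C) — **continuity in the parameter at fixed mesh**: for `δ > 0`, `s ↦ Pext R δ s` is
continuous on `ℝ` (it is a polynomial in `projIcc 0 1 s`: the crude crossing event depends on the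
finitely many vertices with mesh point in the bounded carrier, so its coin-space preimage is a
cylinder event and `prodBernoulli (cornerParam t)` of it is a cylinder polynomial in `t`). -/
def PextContinuous : Prop :=
  ∀ (R : ConformalRectangle) (δ : ℝ), 0 < δ → Continuous (Pext R δ)

/-- STUB (B) — **RussoBound**, the research content of the crux in differential (Lipschitz)
form: the Russo sum is locally bounded in `t`, UNIFORMLY IN THE MESH. (What a bound on the
antidiagonal-odd / five-arm census of pivotal corners delivers; with (R), (C) and the mean value
theorem it implies the crux.) -/
def RussoBound : Prop :=
  ∀ (R : ConformalRectangle) (t₀ : ℝ), t₀ ∈ Set.Icc (0 : ℝ) 1 → ∃ η > 0, ∃ C : ℝ,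
    ∀ δ : ℝ, 0 < δ → ∀ t ∈ Set.Ioo (0 : ℝ) 1, |t - t₀| < η → |deriv (Pext R δ) t| ≤ C

/-- **Integrated form**: a modulus of continuity for `t ↦ P_t(R,δ)` uniform in the mesh. This IS
the crux up to the identification `Pext R δ t = P t R δ` on `[0,1]`
(`uniformMarginality_of_integratedBound`). -/
def IntegratedBound : Prop :=
  ∀ (R : ConformalRectangle) (t₀ : ℝ), t₀ ∈ Set.Icc (0 : ℝ) 1 → ∀ ε > 0, ∃ η > 0,
    ∀ δ : ℝ, 0 < δ → ∀ t ∈ Set.Icc (0 : ℝ) 1, |t - t₀| < η → |Pext R δ t - Pext R δ t₀| < ε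

/-- DIAGNOSTIC IDENTITY of the line (not in the composition) — **pivotal balance** (exact, all
`t ∈ (0,1)`, all meshes; from (R), the conditional law
`P_t(N_v open | rest) = (1 − t/2)𝟙{E_v open} + (t/2)𝟙{E_v closed}` and the transpose symmetry
`cornerPercolation_map_relabel_transpose`):
`E_t[#Piv(A) ; Aᶜ] − E_t[#Piv(A) ; A] = 4 (1 − t) ∂_t P_t`. -/
def PivotalBalance : Prop :=
  ∀ (R : ConformalRectangle) (δ : ℝ), 0 < δ → ∃ K : Finset (Sym2 (Site 2)),
    (∀ ω, pivotals (crossEvent R δ) ω ⊆ (↑K : Set (Sym2 (Site 2)))) ∧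
    ∀ t ∈ Set.Ioo (0 : ℝ) 1,
      ∫ ω, (pivCountIn K (crossEvent R δ) ω : ℝ) *
          (if ω ∈ crossEvent R δ then (-1 : ℝ) else 1) ∂(M t)
        = 4 * (1 - t) * deriv (Pext R δ) t

end Summit.CriticalPhenomena.CardyFormulaZ2.Cruxes.UniformMarginality.HeatFlow

end

/-! ## §3–§4 Proved: cylinder structure and glue -/

namespace Summit.CriticalPhenomena.CardyFormulaZ2.Cruxes.UniformMarginality.HeatFlow

open MeasureTheory Literature.Probability.Percolation Literature.Probability.LatticeModels
  Literature.Probability.RandomPlanarGeometry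

/-! ## §3 Cylinder structure of the crude crossing event (proved; shared by the stub files) -/

/-- The vertices of `ℤ²` whose rescaled embedded point `δ · √2 (y₀ + i y₁)` lies in the carrier
of `R`: the only vertices the crude crossing event looks at. -/
def verts (R : ConformalRectangle) (δ : ℝ) : Set (Site 2) :=
  {y | (δ : ℂ) * squareLatticeEmbedding.z y ∈ R.carrier}

/-- `verts R δ` are the mesh vertices of the carrier at mesh `δ √2`. -/
theorem verts_eq_meshVertices (R : ConformalRectangle) (δ : ℝ) :
    verts R δ = meshVertices R.carrier (δ * Real.sqrt 2) := by
  ext y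
  simp only [verts, Set.mem_setOf_eq, mem_meshVertices_iff, meshPoint]
  rw [show squareLatticeEmbedding.z y = (Real.sqrt 2 : ℂ) * Site.toComplex y from rfl, ← mul_assoc,
    Complex.ofReal_mul]

/-- For `δ > 0` only finitely many vertices are looked at (the carrier is bounded). -/
theorem verts_finite (R : ConformalRectangle) {δ : ℝ} (hδ : 0 < δ) : (verts R δ).Finite := by
  rw [verts_eq_meshVertices]
  exact meshVertices_finite R.isBounded (mul_pos hδ (Real.sqrt_pos.2 two_pos))

/-- The crude crossing event, unfolded to an `openCrossing` event inside `verts R δ`. -/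
theorem crossEvent_eq (R : ConformalRectangle) (δ : ℝ) :
    crossEvent R δ = openCrossing (verts R δ)
      {u | Metric.infDist ((δ : ℂ) * squareLatticeEmbedding.z u) (R.arc 0) ≤ 2 * δ}
      {v | Metric.infDist ((δ : ℂ) * squareLatticeEmbedding.z v) (R.arc 2) ≤ 2 * δ} :=
  rfl

/-- The crude crossing event is increasing. -/
theorem isUpperSet_crossEvent (R : ConformalRectangle) (δ : ℝ) : IsUpperSet (crossEvent R δ) :=
  isUpperSet_embDomainCrossing _ _ _ _ _

/-- The crude crossing event is measurable. -/
theorem measurableSet_crossEvent (R : ConformalRectangle) (δ : ℝ) :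
    MeasurableSet (crossEvent R δ) :=
  measurableSet_embDomainCrossing _ _ _ _ _

/-- For `δ > 0` the crude crossing event is determined by the (finitely many) pairs of vertices
of `verts R δ`. -/
theorem determinedBy_crossEvent (R : ConformalRectangle) {δ : ℝ} (hδ : 0 < δ) :
    DeterminedBy (crossEvent R δ) ↑(verts_finite R hδ).toFinset.sym2 := by
  have h := PlanarDuality.determinedBy_openCrossing (verts_finite R hδ).toFinset
    {u | Metric.infDist ((δ : ℂ) * squareLatticeEmbedding.z u) (R.arc 0) ≤ 2 * δ}
    {v | Metric.infDist ((δ : ℂ) * squareLatticeEmbedding.z v) (R.arc 2) ≤ 2 * δ}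
  rwa [Set.Finite.coe_toFinset] at h

/-- An edge not joining two vertices of `verts R δ` is never pivotal for the crude crossing
event (`δ > 0`). -/
theorem not_isPivotal_crossEvent (R : ConformalRectangle) {δ : ℝ} (hδ : 0 < δ) {e : Sym2 (Site 2)}
    (he : e ∉ (verts_finite R hδ).toFinset.sym2) (ω : BondConfig (Site 2)) :
    ¬ IsPivotal (crossEvent R δ) e ω := by
  have hagree : insert e ω ∩ ↑(verts_finite R hδ).toFinset.sym2 =
      ω \ {e} ∩ ↑(verts_finite R hδ).toFinset.sym2 := by
    ext f
    simp only [Set.mem_inter_iff, Set.mem_insert_iff, Set.mem_sdiff, Set.mem_singleton_iff,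
      Finset.mem_coe]
    constructor
    · rintro ⟨hf | hf, hfK⟩
      · exact absurd (hf ▸ hfK) he
      · exact ⟨⟨hf, fun hfe => he (hfe ▸ hfK)⟩, hfK⟩
    · rintro ⟨⟨hf, -⟩, hfK⟩
      exact ⟨Or.inr hf, hfK⟩
  have hd := (determinedBy_iff _ _).1 (determinedBy_crossEvent R hδ) (insert e ω) (ω \ {e}) hagree
  unfold IsPivotal
  rw [hd]
  exact fun h => h.elim (fun h1 => h1.2 h1.1) (fun h2 => h2.2 h2.1)

/-- The north edge of a vertex outside `verts R δ` is never pivotal (`δ > 0`). -/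
theorem not_isPivotal_northEdge (R : ConformalRectangle) {δ : ℝ} (hδ : 0 < δ) {v : Site 2}
    (hv : v ∉ (verts_finite R hδ).toFinset) (ω : BondConfig (Site 2)) :
    ¬ IsPivotal (crossEvent R δ) (northEdge v) ω := by
  refine not_isPivotal_crossEvent R hδ (fun h => hv ?_) ω
  exact Finset.mem_sym2_iff.1 h v (Sym2.mem_mk_left _ _)

/-- The east edge of a vertex outside `verts R δ` is never pivotal (`δ > 0`). -/
theorem not_isPivotal_eastEdge (R : ConformalRectangle) {δ : ℝ} (hδ : 0 < δ) {v : Site 2}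
    (hv : v ∉ (verts_finite R hδ).toFinset) (ω : BondConfig (Site 2)) :
    ¬ IsPivotal (crossEvent R δ) (eastEdge v) ω := by
  refine not_isPivotal_crossEvent R hδ (fun h => hv ?_) ω
  exact Finset.mem_sym2_iff.1 h v (Sym2.mem_mk_left _ _)

/-- The coin-space form of the crude crossing event: the sets `S ⊆ ℤ² × {0,1}` of coins and
splitting bits whose corner configuration crosses. -/
def coinEvent (R : ConformalRectangle) (δ : ℝ) : Set (Set (Site 2 × Fin 2)) :=
  {S | cornerConfig S ∈ crossEvent R δ}

/-- `coinEvent` is the `cornerConfig`-preimage of the crude crossing event. -/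
theorem coinEvent_eq_preimage (R : ConformalRectangle) (δ : ℝ) :
    coinEvent R δ = cornerConfig ⁻¹' crossEvent R δ := rfl

/-- The coin-space event is measurable. -/
theorem measurableSet_coinEvent (R : ConformalRectangle) (δ : ℝ) :
    MeasurableSet (coinEvent R δ) :=
  measurable_cornerConfig (measurableSet_crossEvent R δ)

/-- `Pext` is the `prodBernoulli (cornerParam ·)`-probability of the coin-space event along the
projected parameter (definitional). -/
theorem Pext_eq (R : ConformalRectangle) (δ s : ℝ) :
    Pext R δ s = (prodBernoulli (cornerParam (Set.projIcc (0 : ℝ) 1 zero_le_one s))).real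
      (coinEvent R δ) := rfl

/-- `Pext` is an `M`-probability of the crude crossing event. -/
theorem Pext_eq_M (R : ConformalRectangle) (δ s : ℝ) :
    Pext R δ s = (M s).real (crossEvent R δ) := by
  unfold Pext M crossEvent
  exact cornerCrossingProb_eq _ R δ

/-- For `δ > 0` the coin-space event is a cylinder event over the coins and splitting bits of
the finitely many vertices of `verts R δ`. -/
theorem determinedBy_coinEvent (R : ConformalRectangle) {δ : ℝ} (hδ : 0 < δ) :
    DeterminedBy (coinEvent R δ)
      ↑((verts_finite R hδ).toFinset ×ˢ (Finset.univ : Finset (Fin 2))) := by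
  rw [determinedBy_iff]
  intro S S' hSS'
  have hcoin : ∀ v ∈ (verts_finite R hδ).toFinset, ∀ j : Fin 2, ((v, j) ∈ S ↔ (v, j) ∈ S') := by
    intro v hv j
    have hmem : (v, j) ∈ (↑((verts_finite R hδ).toFinset ×ˢ (Finset.univ : Finset (Fin 2))) :
        Set (Site 2 × Fin 2)) := by
      rw [Finset.coe_product, Finset.coe_univ]
      exact ⟨hv, Set.mem_univ _⟩
    constructor
    · intro h; exact ((Set.ext_iff.1 hSS' (v, j)).1 ⟨h, hmem⟩).1
    · intro h; exact ((Set.ext_iff.1 hSS' (v, j)).2 ⟨h, hmem⟩).1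
  -- the two corner configurations agree on the pairs of vertices of `verts R δ`
  have hedge : cornerConfig S ∩ ↑(verts_finite R hδ).toFinset.sym2 =
      cornerConfig S' ∩ ↑(verts_finite R hδ).toFinset.sym2 := by
    ext e
    simp only [Set.mem_inter_iff, Finset.mem_coe]
    by_cases he : e ∈ (zdGraph 2).edgeSet
    · obtain ⟨⟨v, j⟩, rfl⟩ := mem_edgeSet_iff_exists_cornerEdge.1 he
      refine and_congr_left fun hK => ?_
      have hv : v ∈ (verts_finite R hδ).toFinset :=
        Finset.mem_sym2_iff.1 hK v (Sym2.mem_mk_left _ _)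
      rw [cornerEdge_mem_cornerConfig_iff, cornerEdge_mem_cornerConfig_iff]
      have h0 := hcoin v hv 0
      have h1 := hcoin v hv 1
      fin_cases j <;> simp [cornerBit, h0, h1]
    · constructor
      · rintro ⟨h, -⟩; exact absurd (cornerConfig_subset_edgeSet S h) he
      · rintro ⟨h, -⟩; exact absurd (cornerConfig_subset_edgeSet S' h) he
  exact (determinedBy_iff _ _).1 (determinedBy_crossEvent R hδ) _ _ hedge

open Classical in
/-- **Cylinder polynomial form of `Pext`** (`δ > 0`): with `F` the coins and splitting bits of
`verts R δ` and `p = cornerParam (projIcc 0 1 s)`,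
`Pext R δ s = Σ_{T ⊆ F, T ∈ coinEvent} ∏_{i ∈ F} (p_i if i ∈ T else 1 − p_i)`
(`RussoPath.prodBernoulli_real_eq_sum_powerset`). The coordinates of `p` are `1/2` on coins and
`projIcc s / 2` on splitting bits (`coe_cornerParam_apply_one`), so this is a polynomial in
`projIcc 0 1 s`. -/
theorem Pext_eq_sum (R : ConformalRectangle) {δ : ℝ} (hδ : 0 < δ) (s : ℝ) :
    Pext R δ s =
      ∑ T ∈ ((verts_finite R hδ).toFinset ×ˢ (Finset.univ : Finset (Fin 2))).powerset,
        if (↑T : Set (Site 2 × Fin 2)) ∈ coinEvent R δ then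
          ∏ i ∈ (verts_finite R hδ).toFinset ×ˢ (Finset.univ : Finset (Fin 2)),
            (if i ∈ T then ((cornerParam (Set.projIcc (0 : ℝ) 1 zero_le_one s) i : unitInterval) : ℝ)
              else 1 - ((cornerParam (Set.projIcc (0 : ℝ) 1 zero_le_one s) i : unitInterval) : ℝ))
        else 0 := by
  classical
  rw [Pext_eq]
  convert RussoPath.prodBernoulli_real_eq_sum_powerset (determinedBy_coinEvent R hδ)
    (cornerParam (Set.projIcc (0 : ℝ) 1 zero_le_one s)) using 1

/-! ## §4 The proved glue -/

/-- The extended function agrees with the route's `P t R δ` on `[0,1]` (definitional). -/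
theorem Pext_coe (R : ConformalRectangle) (δ : ℝ) (t : unitInterval) :
    Pext R δ (t : ℝ) = cornerCrossingProb t R δ := by
  unfold Pext
  rw [Set.projIcc_val]

/-- **Mean value glue**: (R) (differentiability on `(0,1)`), (C) (continuity) and the δ-uniform
derivative bound (B) give the δ-uniform modulus of continuity `IntegratedBound`
(`exists_deriv_eq_slope` on `[t, t₀] ⊆ [0,1]`, with `η = min η_B (ε / (2 max C 1))`). -/
theorem integratedBound_of (hR : RussoIdentity) (hC : PextContinuous) (hB : RussoBound) :
    IntegratedBound := by
  intro R t₀ ht₀ ε hε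
  obtain ⟨η₁, hη₁, C, hCb⟩ := hB R t₀ ht₀
  set C' : ℝ := max C 1 with hC'
  have hC'pos : 0 < C' := lt_of_lt_of_le one_pos (le_max_right C 1)
  have hCC' : C ≤ C' := le_max_left C 1
  refine ⟨min η₁ (ε / (2 * C')), lt_min hη₁ (by positivity), ?_⟩
  intro δ hδ t ht htt₀
  have hη₁' : |t - t₀| < η₁ := lt_of_lt_of_le htt₀ (min_le_left _ _)
  have hηε : |t - t₀| < ε / (2 * C') := lt_of_lt_of_le htt₀ (min_le_right _ _)
  -- differentiability on `(0,1)` from (R), continuity from (C)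
  obtain ⟨K, -, hderiv⟩ := hR R δ hδ
  have hcont : Continuous (Pext R δ) := hC R δ hδ
  have hdiff : ∀ c ∈ Set.Ioo (0 : ℝ) 1, DifferentiableAt ℝ (Pext R δ) c :=
    fun c hc => (hderiv c hc).differentiableAt
  -- the Lipschitz estimate between two points `a < b` of `[0,1]` within `η₁` of `t₀`
  have key : ∀ a b : ℝ, a ∈ Set.Icc (0 : ℝ) 1 → b ∈ Set.Icc (0 : ℝ) 1 → a < b →
      |a - t₀| < η₁ → |b - t₀| < η₁ → |Pext R δ b - Pext R δ a| ≤ C' * (b - a) := by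
    intro a b ha hb hab haη hbη
    have hco : ContinuousOn (Pext R δ) (Set.Icc a b) := hcont.continuousOn
    have hdo : DifferentiableOn ℝ (Pext R δ) (Set.Ioo a b) := by
      intro c hc
      exact (hdiff c ⟨lt_of_le_of_lt ha.1 hc.1, lt_of_lt_of_le hc.2 hb.2⟩).differentiableWithinAt
    obtain ⟨c, hc, hcslope⟩ := exists_deriv_eq_slope (Pext R δ) hab hco hdo
    have hc01 : c ∈ Set.Ioo (0 : ℝ) 1 := ⟨lt_of_le_of_lt ha.1 hc.1, lt_of_lt_of_le hc.2 hb.2⟩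
    have hcη : |c - t₀| < η₁ := by
      rw [abs_lt] at haη hbη ⊢
      constructor <;> linarith [hc.1, hc.2]
    have hbound : |deriv (Pext R δ) c| ≤ C' := (hCb δ hδ c hc01 hcη).trans hCC'
    have hba : 0 < b - a := sub_pos.2 hab
    have heq : Pext R δ b - Pext R δ a = deriv (Pext R δ) c * (b - a) := by
      rw [hcslope, div_mul_cancel₀ _ hba.ne']
    rw [heq, abs_mul, abs_of_pos hba]
    exact mul_le_mul_of_nonneg_right hbound hba.le
  have ht₀η : |t₀ - t₀| < η₁ := by simpa using hη₁
  rcases lt_trichotomy t t₀ with hlt | heq | hgt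
  · have h := key t t₀ ht ht₀ hlt hη₁' ht₀η
    have hpos : 0 < t₀ - t := sub_pos.2 hlt
    have habs : |t - t₀| = t₀ - t := by rw [abs_sub_comm]; exact abs_of_pos hpos
    calc |Pext R δ t - Pext R δ t₀| = |Pext R δ t₀ - Pext R δ t| := abs_sub_comm _ _
      _ ≤ C' * (t₀ - t) := h
      _ < C' * (ε / (2 * C')) := by rw [← habs]; exact mul_lt_mul_of_pos_left hηε hC'pos
      _ = ε / 2 := by field_simp
      _ < ε := by linarith
  · subst heq; simpa using hε
  · have h := key t₀ t ht₀ ht hgt ht₀η hη₁'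
    have hpos : 0 < t - t₀ := sub_pos.2 hgt
    have habs : |t - t₀| = t - t₀ := abs_of_pos hpos
    calc |Pext R δ t - Pext R δ t₀| ≤ C' * (t - t₀) := h
      _ < C' * (ε / (2 * C')) := by rw [← habs]; exact mul_lt_mul_of_pos_left hηε hC'pos
      _ = ε / 2 := by field_simp
      _ < ε := by linarith

/-- **The integrated bound is the crux `UniformMarginality` by name** (the `let`-blocks of the
crux are `cornerParam`/`cornerConfig`/`cornerCrossingProb` syntactically, and
`dist t t₀ = |t − t₀|` on `unitInterval`). -/
theorem uniformMarginality_of_integratedBound (h : IntegratedBound) :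
    Summit.CriticalPhenomena.CardyFormulaZ2.Theses.CardySelfDualSegment.UniformMarginality := by
  unfold Summit.CriticalPhenomena.CardyFormulaZ2.Theses.CardySelfDualSegment.UniformMarginality
  intro prm cfg P t₀ R ε hε
  obtain ⟨η, hη, hmain⟩ := h R (t₀ : ℝ) t₀.2 ε hε
  refine ⟨η, hη, fun t ht δ hδ => ?_⟩
  have hdist : dist t t₀ = |(t : ℝ) - (t₀ : ℝ)| := by rw [Subtype.dist_eq, Real.dist_eq]
  have key := hmain δ hδ (t : ℝ) t.2 (by rw [← hdist]; exact ht)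
  have hP : ∀ s : unitInterval, P s R δ = Pext R δ (s : ℝ) := by
    intro s
    rw [Pext_coe]
    rfl
  rw [hP t, hP t₀]
  exact key


/-- **Composition of the line**: the three stubs (R), (C), (B) imply the crux decl
`CardySelfDualSegment.UniformMarginality` by name. -/
theorem uniformMarginality_of_stubs (hR : RussoIdentity) (hC : PextContinuous)
    (hB : RussoBound) :
    Summit.CriticalPhenomena.CardyFormulaZ2.Theses.CardySelfDualSegment.UniformMarginality :=
  uniformMarginality_of_integratedBound (integratedBound_of hR hC hB)

end Summit.CriticalPhenomena.CardyFormulaZ2.Cruxes.UniformMarginality.HeatFlow
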